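import Summits.QuantumFields.YangMills.Theorems.LuscherReductionTwistedTraceScalingFPWeightRelative
import Summits.QuantumFields.YangMills.Theorems.LuscherReductionTwistedTraceScalingFPWeightOrbitRep
import HarnessLib

/-!
# THE FADDEEV–POPOV WEIGHT IS CONSTANT ON THE BORN–OPPENHEIMER CORE to relative `O(δ²)` — the deterministic statement at one `β`
# (lane A of S-BASE, crux `TwistedTraceScaling` stmt-QuantumFields-20203, C4 INNER; design note `pub/ym-fleet/ym-luscher-20007-p1/COARSE-DESIGN.md` §23.12 owe (P))

Packaging of (N1) `exists_slice_tubePt` (p638863), (N2)+(N3) `fpWeight_relative_bounds` (this lineage) into the statement the Feshbach assembly consumes.  For scale functions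
`δ` (core/orbit radius), `ρ = M·δ` (fat link radius) and `δg` (gauge width) with `0 < δg ≤ δ³` and `δ` small, at EVERY point `U` of the fat tube `fatTubeRho δ ρ β`:
  `N̄(δg β)·(1 − C·δ(β)²) ≤ N(U) = gaugeAvg (recordWeightRho δ ρ δg β) U ≤ N̄(δg β)·(1 + C·δ(β)²)`
(`N̄ = fpWeightBar`, `C = C(L, M)`), provided `M ≥ 3 + 16K_L` (`K_L` the slice constant of `exists_slicePoint`).  Route: move `U` to the orbit-distance minimiser
(`exists_orbitDist_eq`: all links within `δ` of `1`), then to its slice representative `tubePt p*` (`‖p*‖ ≤ (2+32K)δ`, links within `(2+16K)δ`), where `fpWeight_relative_bounds`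
applies with Gaussian core radius `r = δ²` (so `η = O(δ²)`, tails `e^{−c²δ⁴/(4δg²)} ≤ 4δ²/c²` by `δg ≤ δ³`), support radius `R₁ = 3(L−1)(ρ₁+ρ) + δ² = O(δ)`, `gramDet` ratio `O(δ²)`.
* ★★ `fpWeight_core_at` — the deterministic statement at one `β` under sixteen explicit smallness conditions on `t = δ β` (all of the form `a·t ≤ c`);
the eventually-in-β form and the record instance `δ = β^{-σ}`, `δg = β^{-1}` are in `…FPWeightCore`.
HONEST FRAMING: bookkeeping for a stub of a child of the CONDITIONAL reduction route R2b1; no spectral claim; C4 OPEN; not a gap, not Clay.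
-/

set_option autoImplicit false

noncomputable section

open MeasureTheory Filter Topology Real Module
open scoped BigOperators
open Literature.MathematicalPhysics.QuantumFieldTheory
open Literature.MathematicalPhysics.QuantumLattice

namespace Summit.QuantumFields.YangMills.Theorems.FemtoTransferGap.TwoLattice.ConstTube

open Summit.QuantumFields.YangMills.Theorems.FemtoTransferGap
open Summit.QuantumFields.YangMills.Theorems.FemtoTransferGap.TwoLattice.Avg
open Summit.QuantumFields.YangMills.Theorems.FemtoTransferGap.TwoLattice.Stiff (LinkSpace)

/-! ## §1 Elementary real lemmas -/

/-- The tail at Gaussian core radius `t²` and width `s ≤ t³`: `e^{−κ t⁴/s²} ≤ t²/κ` (`κ, s, t > 0`). [folklore] -/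
theorem exp_tail_le {κ t s : ℝ} (hκ : 0 < κ) (ht : 0 < t) (hs : 0 < s) (hst : s ≤ t ^ 3) :
    Real.exp (-(κ * (t ^ 2) ^ 2 / s ^ 2)) ≤ t ^ 2 / κ := by
  have h1 : κ / t ^ 2 ≤ κ * (t ^ 2) ^ 2 / s ^ 2 := by
    rw [div_le_div_iff₀ (by positivity) (by positivity)]
    have : s ^ 2 ≤ (t ^ 3) ^ 2 := pow_le_pow_left₀ hs.le hst 2
    nlinarith [this, hκ]
  have hy : 0 < κ / t ^ 2 := by positivity
  have h2 : Real.exp (-(κ / t ^ 2)) ≤ 1 / (κ / t ^ 2) := by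
    -- `e^{−y} ≤ 1/y` for `y > 0` (cf. `Literature.NumberTheory.LFunctions.Tao2016.exp_neg_le_inv`)
    have h := Real.add_one_le_exp (κ / t ^ 2)
    rw [Real.exp_neg, inv_eq_one_div]
    exact div_le_div_of_nonneg_left zero_le_one hy (by linarith)
  calc Real.exp (-(κ * (t ^ 2) ^ 2 / s ^ 2)) ≤ Real.exp (-(κ / t ^ 2)) := Real.exp_le_exp.mpr (by linarith)
    _ ≤ 1 / (κ / t ^ 2) := h2
    _ = t ^ 2 / κ := by rw [one_div, inv_div]

/-- Products of `(1 − aᵢ)`: `(1 − a)(1 − b)(1 − c) ≥ 1 − a − b − c` for `0 ≤ a`, `0 ≤ b`, `0 ≤ c ≤ 1`. [folklore] -/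
theorem one_sub_mul_three_ge {a b c : ℝ} (ha : 0 ≤ a) (hb : 0 ≤ b) (hc : 0 ≤ c) (hc1 : c ≤ 1) :
    1 - a - b - c ≤ (1 - a) * ((1 - b) * (1 - c)) := by
  have hY1 : (1 - b) * (1 - c) ≤ 1 := by nlinarith [mul_nonneg hb (by linarith : 0 ≤ 1 - c)]
  have hY : 1 - b - c ≤ (1 - b) * (1 - c) := by nlinarith [mul_nonneg hb hc]
  have h3 : a * ((1 - b) * (1 - c)) ≤ a * 1 := mul_le_mul_of_nonneg_left hY1 ha
  nlinarith [h3, hY]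

/-- The slice-point smallness conditions at `τ = (t/2)²` from four linear conditions on `t`. [folklore] -/
theorem slice_smallness {K ε t : ℝ} (hK : 0 ≤ K) (ht0 : 0 < t) (h1 : t ≤ 1 / 8) (h2 : t ≤ ε / 4) (h3 : 2 * K * t ≤ 1 / 2)
    (h4 : (1 + 16 * K) * t ≤ 1 / 4) :
    (t / 2) ^ 2 ≤ 1 / 50 ∧ Real.sqrt (10 * (t / 2) ^ 2) < ε ∧ 2 * Real.sqrt (2 * (t / 2) ^ 2) < ε ∧ K * Real.sqrt (10 * (t / 2) ^ 2) ≤ 1 / 2 ∧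
      (2 * Real.sqrt ((t / 2) ^ 2) + 8 * (K * Real.sqrt (10 * (t / 2) ^ 2))) ^ 2 / 4 ≤ 1 / 50 ∧
      2 * Real.sqrt ((t / 2) ^ 2) + 8 * (K * Real.sqrt (10 * (t / 2) ^ 2)) ≤ (1 + 16 * K) * t := by
  have hsqτ : Real.sqrt ((t / 2) ^ 2) = t / 2 := Real.sqrt_sq (by linarith)
  have hsq10 : Real.sqrt (10 * (t / 2) ^ 2) ≤ 2 * t := by
    rw [Real.sqrt_le_left (by linarith)]; nlinarith [sq_nonneg t]
  have hsq2 : Real.sqrt (2 * (t / 2) ^ 2) ≤ t := by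
    rw [Real.sqrt_le_left ht0.le]; nlinarith [sq_nonneg t]
  have hKs : K * Real.sqrt (10 * (t / 2) ^ 2) ≤ 2 * K * t := by nlinarith [mul_le_mul_of_nonneg_left hsq10 hK]
  have hR : 2 * Real.sqrt ((t / 2) ^ 2) + 8 * (K * Real.sqrt (10 * (t / 2) ^ 2)) ≤ (1 + 16 * K) * t := by rw [hsqτ]; nlinarith [hKs]
  have hR0 : 0 ≤ 2 * Real.sqrt ((t / 2) ^ 2) + 8 * (K * Real.sqrt (10 * (t / 2) ^ 2)) := by positivity
  refine ⟨by nlinarith, lt_of_le_of_lt hsq10 (by linarith), by linarith, hKs.trans h3, ?_, hR⟩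
  have : (2 * Real.sqrt ((t / 2) ^ 2) + 8 * (K * Real.sqrt (10 * (t / 2) ^ 2))) ^ 2 ≤ ((1 + 16 * K) * t) ^ 2 := pow_le_pow_left₀ hR0 hR 2
  nlinarith

/-- `max (√(10·R²/4)) (2√(2·R²/4)) ≤ 2R` for `R ≥ 0`. [folklore] -/
theorem norm_bound_of_rep {R : ℝ} (hR : 0 ≤ R) : max (Real.sqrt (10 * (R ^ 2 / 4))) (2 * Real.sqrt (2 * (R ^ 2 / 4))) ≤ 2 * R := by
  have hA : Real.sqrt (10 * (R ^ 2 / 4)) ≤ 2 * R := by rw [Real.sqrt_le_left (by linarith)]; nlinarith [sq_nonneg R]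
  have hB : Real.sqrt (2 * (R ^ 2 / 4)) ≤ R := by rw [Real.sqrt_le_left hR]; nlinarith [sq_nonneg R]
  exact max_le hA (by linarith)

/-- `1 − R²/4 ≤ scalarPart W` with `R ≥ 0` gives `‖W − 1‖_F ≤ R`. [folklore] -/
theorem frobNorm_le_of_scalarPart_ge' {W : SU2} {R : ℝ} (hR : 0 ≤ R) (hW : 1 - R ^ 2 / 4 ≤ scalarPart W) :
    frobNorm ((W : Matrix (Fin 2) (Fin 2) ℂ) - 1) ≤ R := by
  have h := frobNorm_le_of_scalarPart_ge (τ := R ^ 2 / 4) (by positivity) hW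
  rwa [show R ^ 2 / 4 = (R / 2) ^ 2 by ring, Real.sqrt_sq (by linarith), show 2 * (R / 2) = R by ring] at h

variable (L : ℕ) [NeZero L]

/-! ## §2 The deterministic core statement -/

/-- ★★ **THE FP WEIGHT ON THE CORE, AT ONE `β`, UNDER EXPLICIT SMALLNESS CONDITIONS.**  Constants: `K, ε` (slice point), `M_T, ε_T` (Taylor), `ε_C` (coercivity), `ε_I` (Gaussian values),
`K_D, ε_D` (`gramDet` ratio), `B, ε_B` (bound on `basedLin`); scales `t = δ β`, `ρ β = M t`, `0 < s = δg β ≤ t³`.  Then on the whole fat tube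
`N̄(s)(1 − C_lo t²) ≤ N(U) ≤ N̄(s)(1 + C_hi t²)` with the displayed constants. [cite: Luscher1983, §3] -/
theorem fpWeight_core_at (hL : Nonempty (NzSite L))
    {K ε : ℝ} (hK : 0 ≤ K)
    (hSP : ∀ w : Edge 3 L → Fin 3 → ℝ, w ∈ balancedSet L → ∀ c : Fin 3 → Fin 3 → ℝ, ‖w‖ < ε → ‖c‖ < ε →
      ∃ ξ : Site 3 L → Fin 3 → ℝ, ∑ x : Site 3 L, ξ x = 0 ∧ ‖ξ‖ ≤ K * ‖w‖ ∧
        gaugeCoordSq L (gaugeTransform (fun x => chartSU2 (ξ x)) (orthoTube L (fun e₁ => chartSU2 (c e₁.2)) w)) = 0)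
    {M_T ε_T : ℝ} (hMT : 0 ≤ M_T) (hεT : 0 < ε_T)
    (hT : ∀ (ξ : basedSubmodule L) (q : balancedSubmodule L × (Fin 3 → Fin 3 → ℝ)), ‖ξ‖ < ε_T → ‖q‖ < ε_T →
      ‖basedFn L (ξ, q) - basedFn L (0, q) - basedLin L q ξ‖ ≤ M_T * ‖ξ‖ ^ 2)
    {ε_C : ℝ} (hC : ∀ q : balancedSubmodule L × (Fin 3 → Fin 3 → ℝ), ‖q‖ < ε_C →
      ∀ ξ : basedSubmodule L, ‖ξ‖ ≤ 4 * sliceConst L * ‖(gaugeModes L).starProjection (basedLin L q ξ)‖)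
    {ε_I : ℝ} (hI : ∀ q : balancedSubmodule L × (Fin 3 → Fin 3 → ℝ), ‖q‖ < ε_I → ∀ {a s : ℝ}, 0 < a → 0 < s →
      ∫ w, Real.exp (-(a * ‖laplaceMap L q w‖ ^ 2 / s ^ 2)) ∂(volume : Measure (NzSite L → Fin 3 → ℝ)) =
        (π * s ^ 2 / a) ^ (finrank ℝ (EuclideanSpace ℝ (NzSite L × Fin 3)) / 2 : ℝ) / Real.sqrt (gramDet L q))
    {K_D ε_D : ℝ} (hKD : 0 ≤ K_D) (hD : ∀ q : balancedSubmodule L × (Fin 3 → Fin 3 → ℝ), ‖q‖ < ε_D → |gramDet L q / gramDet L 0 - 1| ≤ K_D * ‖q‖ ^ 2)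
    {B ε_B : ℝ} (hB0 : 0 ≤ B) (hB : ∀ q : balancedSubmodule L × (Fin 3 → Fin 3 → ℝ), ‖q‖ < ε_B → ‖basedLin L q‖ ≤ B)
    {δ ρ δg : ℝ → ℝ} {β M : ℝ} (hM : 3 + 16 * K ≤ M) (hρ : ρ β = M * δ β) (ht0 : 0 < δ β) (hs0 : 0 < δg β) (hsd : δg β ≤ δ β ^ 3)
    -- smallness of `t = δ β`
    (h1 : δ β ≤ 1 / 8) (h2 : δ β ≤ ε / 4) (h3 : 2 * K * δ β ≤ 1 / 2) (h4 : (1 + 16 * K) * δ β ≤ 1 / 4)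
    (h5 : (2 + 32 * K) * δ β < ε_T) (h6 : (2 + 32 * K) * δ β < ε_C) (h7 : (2 + 32 * K) * δ β < ε_I) (h8 : (2 + 32 * K) * δ β < ε_D)
    (h9 : (2 + 32 * K) * δ β < ε_B) (h10 : (2 + 32 * K) * δ β ≤ 1 / 40)
    (h11 : (3 * ((L : ℝ) - 1) * (2 + 16 * K + M) + 1) * δ β < ε_T)
    (h12 : 4 * sliceConst L * (M_T + 2 * B) * (3 * ((L : ℝ) - 1) * (2 + 16 * K + M) + 1) * δ β ≤ 1 / 4)
    (h13 : (flatDim L / 2 + 1 : ℝ) * (12 * sliceConst L * (M_T + 2 * B)) * δ β ≤ 1 / 4)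
    (h14 : (2 : ℝ) ^ (flatDim L / 2 : ℝ) * (32 * sliceConst L ^ 2) * δ β ≤ 1 / 4)
    (h15 : 6 * (Fintype.card (NzSite L) : ℝ) * (3 * ((L : ℝ) - 1) * (2 + 16 * K + M) + 1) ^ 2 * δ β ≤ 1)
    (h16 : K_D * (2 + 32 * K) ^ 2 * δ β ≤ 1 / 2)
    {U : GaugeConfig 3 L SU2} (hU : U ∈ fatTubeRho L δ ρ β) :
    fpWeightBar L (δg β) * (1 - (6 * (Fintype.card (NzSite L) : ℝ) * (3 * ((L : ℝ) - 1) * (2 + 16 * K + M) + 1) ^ 2 +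
        (flatDim L / 2 : ℝ) * (12 * sliceConst L * (M_T + 2 * B)) + (2 : ℝ) ^ (flatDim L / 2 : ℝ) * (32 * sliceConst L ^ 2) +
        K_D * (2 + 32 * K) ^ 2) * δ β ^ 2) ≤ gaugeAvg (recordWeightRho L δ ρ δg β) U ∧
      gaugeAvg (recordWeightRho L δ ρ δg β) U ≤ fpWeightBar L (δg β) * (1 + (2 * (4 * (flatDim L / 2 : ℝ) * (12 * sliceConst L * (M_T + 2 * B)) +
        (4 : ℝ) ^ (flatDim L / 2 : ℝ) * (64 * sliceConst L ^ 2)) + K_D * (2 + 32 * K) ^ 2) * δ β ^ 2) := by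
  -- names
  set t : ℝ := δ β with htdef
  have hCpos := sliceConst_pos L
  have ht1 : t ≤ 1 := by linarith only [h1]
  have htt : t ^ 2 ≤ t := by nlinarith only [ht0, ht1]
  have hL1 : (1 : ℝ) ≤ (L : ℝ) := by exact_mod_cast NeZero.one_le
  -- STEP 1: the orbit-distance minimiser puts every link within `t` of `1`
  obtain ⟨g₀, hg₀⟩ := exists_orbitDist_eq U
  have hUorb : orbitDist U < t := hU.2
  set U₀ : GaugeConfig 3 L SU2 := gaugeTransform g₀ U with hU₀def
  have hU₀link : ∀ e : Edge 3 L, frobNorm (((U₀ e : SU2) : Matrix (Fin 2) (Fin 2) ℂ) - 1) ≤ t := fun e =>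
    ((frobNorm_link_le_gaugeDist L g₀ U e).trans (by rw [hg₀]; exact hUorb.le))
  have hU₀sc : ∀ e : Edge 3 L, 1 - (t / 2) ^ 2 ≤ scalarPart (U₀ e) := fun e => by
    have := scalarPart_ge_of_frobNorm_le (hU₀link e); rw [show (t / 2) ^ 2 = t ^ 2 / 4 by ring]; exact this
  -- STEP 2: the slice representative
  obtain ⟨hτ50, hτε1, hτε2, hτK, hτ', hRle⟩ := slice_smallness hK ht0 h1 h2 h3 h4
  obtain ⟨ξ, p, htube, hslice, hsc, -, hpn⟩ := exists_slice_tubePt L hK hSP (sq_nonneg (t / 2)) hτ50 hτε1 hτε2 hτK hτ' hU₀sc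
  set R : ℝ := 2 * Real.sqrt ((t / 2) ^ 2) + 8 * (K * Real.sqrt (10 * (t / 2) ^ 2)) with hRdef
  have hR0 : 0 ≤ R := by rw [hRdef]; positivity
  -- size of `p`
  have hP0 : 0 ≤ (2 + 32 * K) * t := by positivity
  have hp : ‖p‖ ≤ (2 + 32 * K) * t := (hpn.trans (norm_bound_of_rep hR0)).trans (by linarith only [hRle])
  have hpT : ‖p‖ < ε_T := lt_of_le_of_lt hp h5
  have hpC : ‖p‖ < ε_C := lt_of_le_of_lt hp h6
  have hpI : ∀ {a s' : ℝ}, 0 < a → 0 < s' → ∫ w, Real.exp (-(a * ‖laplaceMap L p w‖ ^ 2 / s' ^ 2)) ∂(volume : Measure (NzSite L → Fin 3 → ℝ)) =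
      (π * s' ^ 2 / a) ^ (finrank ℝ (EuclideanSpace ℝ (NzSite L × Fin 3)) / 2 : ℝ) / Real.sqrt (gramDet L p) :=
    fun ha hs' => hI p (lt_of_le_of_lt hp h7) ha hs'
  have hpD := hD p (lt_of_le_of_lt hp h8)
  have hpB := hB p (lt_of_le_of_lt hp h9)
  have hp40 : ‖p‖ ≤ 1 / 40 := hp.trans h10
  -- links of the representative and its fat-tube membership
  set ρ₁ : ℝ := (2 + 16 * K) * t with hρ₁def
  have hlinks : ∀ e : Edge 3 L, frobNorm (((tubePt L p e : SU2) : Matrix (Fin 2) (Fin 2) ℂ) - 1) < ρ₁ := fun e => by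
    have h := frobNorm_le_of_scalarPart_ge' hR0 (hsc e)
    have : R < ρ₁ := by rw [hρ₁def]; linarith only [hRle, ht0]
    exact lt_of_le_of_lt h this
  obtain ⟨hNrep, hOrep⟩ := gaugeAvg_tubePt_rep L (δ := δ) (ρ := ρ) (δg := δg) (β := β) htube
  have hUfat : tubePt L p ∈ fatTubeRho L δ (fun _ => ρ₁) β := by
    refine ⟨fun e => hlinks e, ?_⟩
    show orbitDist (tubePt L p) < δ β
    rw [hOrep, hU₀def, orbitDist_gaugeTransform]; exact hUorb
  -- `N(U) = N(tubePt p)`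
  have hNU : gaugeAvg (recordWeightRho L δ ρ δg β) U = gaugeAvg (recordWeightRho L δ ρ δg β) (tubePt L p) := by
    rw [hNrep, hU₀def, gaugeAvg_recordWeightRho_gaugeTransform]
  -- STEP 3: radii and the hypotheses of the relative bounds
  set Q : ℝ := 3 * ((L : ℝ) - 1) * (2 + 16 * K + M) + 1 with hQdef
  have hM0 : 0 ≤ M := by linarith only [hM, hK]
  have hX0 : 0 ≤ 3 * ((L : ℝ) - 1) * (2 + 16 * K + M) := mul_nonneg (mul_nonneg (by norm_num) (sub_nonneg.mpr hL1)) (by linarith only [hK, hM0])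
  have hQ1 : 1 ≤ Q := by rw [hQdef]; linarith only [hX0]
  have hQ0 : 0 ≤ Q := by linarith only [hQ1]
  set R₁ : ℝ := 3 * ((L : ℝ) - 1) * (ρ₁ + ρ β) + t ^ 2 with hR₁def
  have hR₁Q : R₁ ≤ Q * t := by
    rw [hR₁def, hQdef, hρ₁def, hρ]
    have : 3 * ((L : ℝ) - 1) * ((2 + 16 * K) * t + M * t) = 3 * ((L : ℝ) - 1) * (2 + 16 * K + M) * t := by ring
    rw [this]; linarith only [htt]
  have hR₁0 : 0 ≤ 3 * ((L : ℝ) - 1) * (ρ₁ + ρ β) := by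
    rw [hρ, hρ₁def]; exact mul_nonneg (mul_nonneg (by norm_num) (sub_nonneg.mpr hL1)) (by positivity)
  have hrR : t ^ 2 ≤ R₁ := by rw [hR₁def]; linarith only [hR₁0]
  have hQt : Q * t < ε_T := h11
  have hR1T : R₁ < ε_T := lt_of_le_of_lt hR₁Q hQt
  have hn1 : (1 : ℝ) ≤ (Fintype.card (NzSite L) : ℝ) := by exact_mod_cast Fintype.card_pos
  have hR1half : R₁ ≤ 1 / 2 := by
    -- from `h15`: `6 n Q² t ≤ 1` with `n ≥ 1`, `Q ≥ 1` gives `Q t ≤ Q² t ≤ 1/6`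
    have e1 : 1 * (Q * t) ≤ Q * (Q * t) := mul_le_mul_of_nonneg_right hQ1 (mul_nonneg hQ0 ht0.le)
    have e2 : Q ^ 2 * t ≤ (Fintype.card (NzSite L) : ℝ) * (Q ^ 2 * t) := le_mul_of_one_le_left (by positivity) hn1
    have e3 : Q * (Q * t) = Q ^ 2 * t := by ring
    have e4 : (Fintype.card (NzSite L) : ℝ) * (Q ^ 2 * t) = (Fintype.card (NzSite L) : ℝ) * Q ^ 2 * t := by ring
    linarith only [e1, e2, e3, e4, h15, hR₁Q]
  have hcore : ρ₁ + 8 * t ^ 2 ≤ ρ β := by rw [hρ, hρ₁def]; nlinarith only [hM, h1, ht0]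
  have hsupp : 3 * ((L : ℝ) - 1) * (ρ₁ + ρ β) ≤ R₁ := by rw [hR₁def]; linarith only [sq_nonneg t]
  have hBp : M_T + 2 * ‖basedLin L p‖ ≤ M_T + 2 * B := by linarith only [hpB]
  have hθ : (M_T + 2 * ‖basedLin L p‖) * R₁ * (4 * sliceConst L) ≤ 1 / 4 := by
    have hR₁0' : 0 ≤ R₁ := le_trans (sq_nonneg t) hrR
    calc (M_T + 2 * ‖basedLin L p‖) * R₁ * (4 * sliceConst L) ≤ (M_T + 2 * B) * (Q * t) * (4 * sliceConst L) := by
          gcongr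
      _ = 4 * sliceConst L * (M_T + 2 * B) * Q * t := by ring
      _ ≤ 1 / 4 := h12
  -- `η ≤ 12 C_L (M_T + 2B) t²`
  have hηle : fpEta L M_T p (t ^ 2) ≤ 12 * sliceConst L * (M_T + 2 * B) * t ^ 2 := by
    unfold fpEta
    calc 3 * ((M_T + 2 * ‖basedLin L p‖) * t ^ 2 * (4 * sliceConst L)) ≤ 3 * ((M_T + 2 * B) * t ^ 2 * (4 * sliceConst L)) := by gcongr
      _ = 12 * sliceConst L * (M_T + 2 * B) * t ^ 2 := by ring
  have hA2_0 : 0 ≤ 12 * sliceConst L * (M_T + 2 * B) := by positivity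
  have hd0 : (0 : ℝ) ≤ (flatDim L / 2 : ℝ) := by positivity
  have hAt0 : 0 ≤ 12 * sliceConst L * (M_T + 2 * B) * t := mul_nonneg hA2_0 ht0.le
  have eA1 : 12 * sliceConst L * (M_T + 2 * B) * t ^ 2 ≤ 12 * sliceConst L * (M_T + 2 * B) * t := by
    have := mul_le_mul_of_nonneg_left htt hA2_0; linarith only [this]
  have eA2 : 12 * sliceConst L * (M_T + 2 * B) * t ≤ (flatDim L / 2 + 1 : ℝ) * (12 * sliceConst L * (M_T + 2 * B)) * t := by
    have := mul_nonneg hd0 hAt0; linarith only [this]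
  have hη2 : fpEta L M_T p (t ^ 2) ≤ 1 / 2 := by linarith only [hηle, eA1, eA2, h13]
  have hηd : (flatDim L / 2 : ℝ) * fpEta L M_T p (t ^ 2) ≤ 1 / 4 := by
    have e1 := mul_le_mul_of_nonneg_left hηle hd0
    have e2 := mul_le_mul_of_nonneg_left eA1 hd0
    linarith only [e1, e2, hAt0, h13]
  -- tails
  have hc2 : (1 / (4 * sliceConst L)) ^ 2 = 1 / (16 * sliceConst L ^ 2) := by field_simp; ring
  have htail1 : (2 : ℝ) ^ (flatDim L / 2 : ℝ) * Real.exp (-((1 / (4 * sliceConst L)) ^ 2 * (t ^ 2) ^ 2 / (2 * δg β ^ 2))) ≤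
      (2 : ℝ) ^ (flatDim L / 2 : ℝ) * (32 * sliceConst L ^ 2) * t ^ 2 := by
    have hκ : (0 : ℝ) < 1 / (32 * sliceConst L ^ 2) := by positivity
    have e1 : (1 / (4 * sliceConst L)) ^ 2 * (t ^ 2) ^ 2 / (2 * δg β ^ 2) = 1 / (32 * sliceConst L ^ 2) * (t ^ 2) ^ 2 / δg β ^ 2 := by
      rw [hc2]; field_simp; ring
    rw [e1]
    have h := exp_tail_le hκ ht0 hs0 hsd
    rw [show t ^ 2 / (1 / (32 * sliceConst L ^ 2)) = 32 * sliceConst L ^ 2 * t ^ 2 by field_simp] at h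
    calc (2 : ℝ) ^ (flatDim L / 2 : ℝ) * Real.exp (-(1 / (32 * sliceConst L ^ 2) * (t ^ 2) ^ 2 / δg β ^ 2))
        ≤ (2 : ℝ) ^ (flatDim L / 2 : ℝ) * (32 * sliceConst L ^ 2 * t ^ 2) := mul_le_mul_of_nonneg_left h (by positivity)
      _ = _ := by ring
  have htail2 : (4 : ℝ) ^ (flatDim L / 2 : ℝ) * Real.exp (-((1 / (4 * sliceConst L)) ^ 2 * (t ^ 2) ^ 2 / (4 * δg β ^ 2))) ≤
      (4 : ℝ) ^ (flatDim L / 2 : ℝ) * (64 * sliceConst L ^ 2) * t ^ 2 := by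
    have hκ : (0 : ℝ) < 1 / (64 * sliceConst L ^ 2) := by positivity
    have e1 : (1 / (4 * sliceConst L)) ^ 2 * (t ^ 2) ^ 2 / (4 * δg β ^ 2) = 1 / (64 * sliceConst L ^ 2) * (t ^ 2) ^ 2 / δg β ^ 2 := by
      rw [hc2]; field_simp; ring
    rw [e1]
    have h := exp_tail_le hκ ht0 hs0 hsd
    rw [show t ^ 2 / (1 / (64 * sliceConst L ^ 2)) = 64 * sliceConst L ^ 2 * t ^ 2 by field_simp] at h
    calc (4 : ℝ) ^ (flatDim L / 2 : ℝ) * Real.exp (-(1 / (64 * sliceConst L ^ 2) * (t ^ 2) ^ 2 / δg β ^ 2))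
        ≤ (4 : ℝ) ^ (flatDim L / 2 : ℝ) * (64 * sliceConst L ^ 2 * t ^ 2) := mul_le_mul_of_nonneg_left h (by positivity)
      _ = _ := by ring
  have htail : (2 : ℝ) ^ (flatDim L / 2 : ℝ) * Real.exp (-((1 / (4 * sliceConst L)) ^ 2 * (t ^ 2) ^ 2 / (2 * δg β ^ 2))) ≤ 1 / 4 := by
    have e := mul_le_mul_of_nonneg_left htt (by positivity : (0:ℝ) ≤ (2 : ℝ) ^ (flatDim L / 2 : ℝ) * (32 * sliceConst L ^ 2))
    linarith only [htail1, e, h14]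
  -- `6 n R₁² ≤ 1`
  have hn0 : (0 : ℝ) ≤ (Fintype.card (NzSite L) : ℝ) := by positivity
  have hR₁sq : R₁ ^ 2 ≤ Q ^ 2 * t ^ 2 := by
    have := pow_le_pow_left₀ (le_trans (sq_nonneg t) hrR) hR₁Q 2; rw [mul_pow] at this; exact this
  have hRn' : 6 * (Fintype.card (NzSite L) : ℝ) * R₁ ^ 2 ≤ 6 * (Fintype.card (NzSite L) : ℝ) * Q ^ 2 * t ^ 2 := by
    have := mul_le_mul_of_nonneg_left hR₁sq (by positivity : (0:ℝ) ≤ 6 * (Fintype.card (NzSite L) : ℝ)); linarith only [this]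
  have hRn : 6 * (Fintype.card (NzSite L) : ℝ) * R₁ ^ 2 ≤ 1 := by
    have := mul_le_mul_of_nonneg_left htt (by positivity : (0:ℝ) ≤ 6 * (Fintype.card (NzSite L) : ℝ) * Q ^ 2); linarith only [hRn', this, h15]
  -- `gramDet` ratio
  set x : ℝ := K_D * (2 + 32 * K) ^ 2 * t ^ 2 with hxdef
  have hx : |gramDet L p / gramDet L 0 - 1| ≤ x := by
    refine hpD.trans ?_
    rw [hxdef]
    have h' : ‖p‖ ^ 2 ≤ ((2 + 32 * K) * t) ^ 2 := pow_le_pow_left₀ (norm_nonneg _) hp 2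
    have h'' := mul_le_mul_of_nonneg_left h' hKD
    have e : K_D * ((2 + 32 * K) * t) ^ 2 = K_D * (2 + 32 * K) ^ 2 * t ^ 2 := by ring
    linarith only [h'', e]
  have hx2 : x ≤ 1 / 2 := by
    rw [hxdef]
    have := mul_le_mul_of_nonneg_left htt (by positivity : (0:ℝ) ≤ K_D * (2 + 32 * K) ^ 2); linarith only [this, h16]
  have hx0 : 0 ≤ x := by rw [hxdef]; positivity
  -- STEP 4: the relative bounds at the representative
  obtain ⟨hlo, hhi⟩ := fpWeight_relative_bounds L hL hs0 p hpI hMT hεT hT hC hpT hpC hp40 hslice hUfat (sq_nonneg t) hrR hR1half hR1T hcore hsupp hθ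
    hη2 hηd htail hRn hx hx2
  have hbar0 := (fpWeightBar_pos L hs0).le
  rw [hNU]
  constructor
  · -- LOWER: `(1 − a)(1 − b − c)(1 − x) ≥ 1 − a − (b + c) − x ≥ 1 − C_lo t²`
    refine le_trans ?_ hlo
    refine mul_le_mul_of_nonneg_left ?_ hbar0
    have ha : 0 ≤ 6 * (Fintype.card (NzSite L) : ℝ) * R₁ ^ 2 := by positivity
    have hb0 : 0 ≤ (flatDim L / 2 : ℝ) * fpEta L M_T p (t ^ 2) := mul_nonneg (by positivity) (fpEta_nonneg L hMT p (sq_nonneg t))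
    have hc0 : 0 ≤ (2 : ℝ) ^ (flatDim L / 2 : ℝ) * Real.exp (-((1 / (4 * sliceConst L)) ^ 2 * (t ^ 2) ^ 2 / (2 * δg β ^ 2))) := by positivity
    have h3f := one_sub_mul_three_ge ha (add_nonneg hb0 hc0) hx0 (by linarith only [hx2])
    have hbt : (flatDim L / 2 : ℝ) * fpEta L M_T p (t ^ 2) ≤ (flatDim L / 2 : ℝ) * (12 * sliceConst L * (M_T + 2 * B)) * t ^ 2 := by
      have := mul_le_mul_of_nonneg_left hηle hd0; linarith only [this]
    linarith only [h3f, hbt, htail1, hRn', hxdef]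
  · -- UPPER: `(1 + b' + c')(1 + x) ≤ 1 + 2(b' + c') + x` when `x ≤ 1`
    refine hhi.trans (mul_le_mul_of_nonneg_left ?_ hbar0)
    have hbt : 4 * (flatDim L / 2 : ℝ) * fpEta L M_T p (t ^ 2) ≤ 4 * (flatDim L / 2 : ℝ) * (12 * sliceConst L * (M_T + 2 * B)) * t ^ 2 := by
      have := mul_le_mul_of_nonneg_left hηle hd0; linarith only [this]
    have hb0 : 0 ≤ 4 * (flatDim L / 2 : ℝ) * fpEta L M_T p (t ^ 2) := by
      have := fpEta_nonneg L hMT p (sq_nonneg t); positivity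
    have hc0 : 0 ≤ (4 : ℝ) ^ (flatDim L / 2 : ℝ) * Real.exp (-((1 / (4 * sliceConst L)) ^ 2 * (t ^ 2) ^ 2 / (4 * δg β ^ 2))) := by positivity
    have hx1 : x ≤ 1 := by linarith only [hx2]
    have hbx : (1 + 4 * (flatDim L / 2 : ℝ) * fpEta L M_T p (t ^ 2) +
          (4 : ℝ) ^ (flatDim L / 2 : ℝ) * Real.exp (-((1 / (4 * sliceConst L)) ^ 2 * (t ^ 2) ^ 2 / (4 * δg β ^ 2)))) * (1 + x) ≤
        1 + 2 * (4 * (flatDim L / 2 : ℝ) * fpEta L M_T p (t ^ 2) +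
          (4 : ℝ) ^ (flatDim L / 2 : ℝ) * Real.exp (-((1 / (4 * sliceConst L)) ^ 2 * (t ^ 2) ^ 2 / (4 * δg β ^ 2)))) + x := by
      have := mul_le_mul_of_nonneg_left hx1 (add_nonneg hb0 hc0); linarith only [this, hb0, hc0, hx0]
    linarith only [hbx, hbt, htail2, hxdef]

end Summit.QuantumFields.YangMills.Theorems.FemtoTransferGap.TwoLattice.ConstTube

end
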